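import Summits.ResolutionOfSingularities.ResolutionOfSingularities.Theorems.EquisingularLiftCampaignW45bEquisingularLiftNat
import HarnessLib

/-!
# [OURS · L1 W4.5(b)] PER-`H` PREDICATES of EL♮ — `EquisingularLift.ELNatAt p k n H ι` and `EquisingularLift.ELNatOver p k n H ι O π`
# (statement-only typing + pure-logic anchors; res-L1-w45b-plan-1 ORDERS 05:49:16Z (R4))

Everything here is OURS: the body of the EL♮ item `EquisingularLiftNat p` (`Theorems/EquisingularLiftCampaignW45bEquisingularLiftNat.lean`,
res-L1-type-o1 p482511 → v2 p484593; item text `L/w45b/EL-NATURAL/sig-EquisingularLiftNat.importfree.txt` e7ca4a6668c5c33a =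
stmt-ResolutionOfSingularities-20038) CUT at two places so that rungs, specimens and K-LSE kill tests can CONCLUDE PER HYPERSURFACE `H`
(plan-1: «every POSITIVE rung of the n = 3 stub has the shape “exhibit admissible horizontal E1 steps + check that the downstairs blow-up of
H is regular”; R0/R2 and every K-LSE rung consume it by name»). Bodies = the item string byte-for-byte (text surgery, nothing re-typed).
Nothing here is a statement of Hironaka's manuscript (EL♮ replaces the role of NOTHING in the manuscript — it is the W4.5(b) door); no
`Literature.…` FACT is used. Typed by res-L1-type-o1 (OURS typer o1, gen 6, 2026-08-27) on res-L1-w45b-plan-1's ORDERS 05:49:16Z (R4).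
Host: `--supports stmt-ResolutionOfSingularities-20038 --as helper`. ROUTE-INDEPENDENT (the EL♮ statement file imports no `Theses/…`).

* `ELNatAt p k n H ι` — the item body AFTER the `H`-binders: «there are a characteristic-0 DVR `O` with a surjection `π : O → k` such that
  for every graded `φ` inducing `MvPolynomial.map π` and `Y = range (ι ≫ Proj.map φ)` there are `(P′, σ, S′)` in the E1-chain closure of
  `(ℙⁿ_O, 𝟙, Y)` with irreducible special fibre of `P′` and regular reduced closure of `S′`» — EL♮ FOR THIS `H`.
* `ELNatOver p k n H ι O π` — the same AFTER «`Function.Surjective π ∧`» for a FIXED DVR `O` (structure as instance binders) and a FIXED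
  `π : O →+* k`: EL♮ for this `H` OVER this `(O, π)` — the shape a specimen proof produces (it constructs ONE `O`, e.g. the Witt/Cohen
  ring of the `n ≤ 2` proof, by name).
* Pure logic: `equisingularLiftNat_iff_forall_elNatAt` (the item = its hypotheses in front of `ELNatAt`, `Iff.rfl`), `elNatAt_of_elNatOver`
  (fix `(O, π)`, add surjectivity), `elNatAt.intro`-style use is then `⟨O, _, _, _, _, π, hπ, h⟩`.

VACUITY / STRENGTH (typer): per-`H` slices of a FRONTIER-class item — `ELNatAt` is exactly as strong as the item at that `H` (neither
trivially true nor false: for `n ≥ 5` the family over all `H` implies resolution of hypersurfaces; PROVED for `n ≤ 2` by the chain's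
`stub_elnat_le_two` p498502 in the E2 form); `ELNatOver` additionally fixes the lift ring — stronger per instance, the natural output of a
construction. Hypotheses satisfiable (every integral hypersurface `H ⊂ ℙⁿ_k`). AI-WRITTEN; NO expert review; AI review is weaker than
expert review. References: ORDERS 05:49:16Z (R0–R5); L/w45b/EL-NATURAL/SkeletonELnat-v3.lean (lead-2 05:49:11Z) — OURS planning texts.
-/

noncomputable section

set_option linter.dupNamespace false -- mandated namespace of this single-conjunct summit

namespace Summit.ResolutionOfSingularities.ResolutionOfSingularities.Theorems

namespace EquisingularLift

/-- [OURS · L1 W4.5(b)] replaces the role of NOTHING in the manuscript; NOT a statement of the manuscript. **EL♮ AT ONE HYPERSURFACE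
`(k, n, H, ι)`** — the body of the item `EquisingularLiftNat p` after its `H`-binders, byte-for-byte (res-L1-w45b-plan-1 ORDERS (R4)): a
characteristic-0 DVR `O` with a surjection `π : O → k` exists such that for every graded `φ` inducing `MvPolynomial.map π` and
`Y = range (ι ≫ Proj.map φ)` some `(P′, σ, S′)` in the E1-chain closure of `(ℙⁿ_O, 𝟙, Y)` has irreducible special fibre and regular
reduced closure `V(closure S′)_red`. `EquisingularLiftNat p ↔ (p.Prime → ∀ …binders…, ELNatAt p k n H ι)` is `Iff.rfl`
(`equisingularLiftNat_iff_forall_elNatAt`). [folklore] -/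
def ELNatAt (p : ℕ) (k : Type) [Field k] [CharP k p] [IsAlgClosed k] (n : ℕ) (H : AlgebraicGeometry.Scheme.{0})
    (ι : H ⟶ (Literature.AlgebraicGeometry.Motives.projectiveSpace n k).left) : Prop :=
  ∃ (O : Type) (_ : CommRing O) (_ : IsDomain O) (_ : IsDiscreteValuationRing O) (_ : CharZero O) (π : O →+* k), Function.Surjective π ∧ (letI := MvPolynomial.gradedAlgebra (σ := Fin (n + 1)) (R := O); letI := MvPolynomial.gradedAlgebra (σ := Fin (n + 1)) (R := k); ∀ (φ : MvPolynomial.homogeneousSubmodule (Fin (n + 1)) O →+*ᵍ MvPolynomial.homogeneousSubmodule (Fin (n + 1)) k) (hφ' : HomogeneousIdeal.irrelevant (MvPolynomial.homogeneousSubmodule (Fin (n + 1)) k) ≤ (HomogeneousIdeal.irrelevant (MvPolynomial.homogeneousSubmodule (Fin (n + 1)) O)).map φ), (∀ s, φ s = MvPolynomial.map π s) → ∀ Y : Set (AlgebraicGeometry.Proj (MvPolynomial.homogeneousSubmodule (Fin (n + 1)) O)), Y = Set.range (CategoryTheory.CategoryStruct.comp ι (AlgebraicGeometry.Proj.map φ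 hφ') : H ⟶ (AlgebraicGeometry.Proj (MvPolynomial.homogeneousSubmodule (Fin (n + 1)) O))) → ∃ (P' : AlgebraicGeometry.Scheme.{0}) (σ : P' ⟶ (AlgebraicGeometry.Proj (MvPolynomial.homogeneousSubmodule (Fin (n + 1)) O))) (S' : Set P'), (∀ Q : (∀ X' : AlgebraicGeometry.Scheme.{0}, (X' ⟶ (AlgebraicGeometry.Proj (MvPolynomial.homogeneousSubmodule (Fin (n + 1)) O))) → Set X' → Prop), Q (AlgebraicGeometry.Proj (MvPolynomial.homogeneousSubmodule (Fin (n + 1)) O)) (CategoryTheory.CategoryStruct.id _) Y → (∀ (X' X'' : AlgebraicGeometry.Scheme.{0}) (σ' : X' ⟶ (AlgebraicGeometry.Proj (MvPolynomial.homogeneousSubmodule (Fin (n + 1)) O))) (Y' : Set X') (C : X'.IdealSheafData) (τ : X'' ⟶ X'), Q X' σ' Y' → Literature.AlgebraicGeometry.Resolution.IsBlowup τ C → Literature.AlgebraicGeometry.Resolution.Scheme.IsRegular C.subscheme → σ' '' (C.support : Set X') ⊆ {x | ¬ IsGenericPoint x Y} → (C.support : Set X') ∩ (CategoryTheory.CategoryStruct.comp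 σ' (CategoryTheory.CategoryStruct.comp (AlgebraicGeometry.Proj.toSpecZero (MvPolynomial.homogeneousSubmodule (Fin (n + 1)) O)) (AlgebraicGeometry.Spec.map (CommRingCat.ofHom (algebraMap O (MvPolynomial.homogeneousSubmodule (Fin (n + 1)) O 0)))))) ⁻¹' {IsLocalRing.closedPoint O} ⊆ Y' → Q X'' (CategoryTheory.CategoryStruct.comp τ σ') (closure (τ ⁻¹' (Y' \ (C.support : Set X'))))) → Q P' σ S') ∧ IsIrreducible ((CategoryTheory.CategoryStruct.comp σ (CategoryTheory.CategoryStruct.comp (AlgebraicGeometry.Proj.toSpecZero (MvPolynomial.homogeneousSubmodule (Fin (n + 1)) O)) (AlgebraicGeometry.Spec.map (CommRingCat.ofHom (algebraMap O (MvPolynomial.homogeneousSubmodule (Fin (n + 1)) O 0)))))) ⁻¹' {IsLocalRing.closedPoint O}) ∧ Literature.AlgebraicGeometry.Resolution.Scheme.IsRegular (AlgebraicGeometry.Scheme.IdealSheafData.vanishingIdeal (⟨closure S', isClosed_closure⟩ : TopologicalSpace.Closeds P')).subscheme)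

/-- [OURS · L1 W4.5(b)] replaces the role of NOTHING in the manuscript; NOT a statement of the manuscript. **EL♮ AT ONE HYPERSURFACE OVER A
FIXED LIFT RING `(O, π)`** — the item body after «`Function.Surjective π ∧`», byte-for-byte, with `O`'s structure as instance binders
(res-L1-w45b-plan-1 ORDERS (R4)): the shape a specimen / rung proof PRODUCES (it names its `O`). With `Function.Surjective π` it gives
`ELNatAt` (`elNatAt_of_elNatOver`). [folklore] -/
def ELNatOver (p : ℕ) (k : Type) [Field k] [CharP k p] [IsAlgClosed k] (n : ℕ) (H : AlgebraicGeometry.Scheme.{0})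
    (ι : H ⟶ (Literature.AlgebraicGeometry.Motives.projectiveSpace n k).left) (O : Type) [CommRing O] [IsDomain O]
    [IsDiscreteValuationRing O] [CharZero O] (π : O →+* k) : Prop :=
  (letI := MvPolynomial.gradedAlgebra (σ := Fin (n + 1)) (R := O); letI := MvPolynomial.gradedAlgebra (σ := Fin (n + 1)) (R := k); ∀ (φ : MvPolynomial.homogeneousSubmodule (Fin (n + 1)) O →+*ᵍ MvPolynomial.homogeneousSubmodule (Fin (n + 1)) k) (hφ' : HomogeneousIdeal.irrelevant (MvPolynomial.homogeneousSubmodule (Fin (n + 1)) k) ≤ (HomogeneousIdeal.irrelevant (MvPolynomial.homogeneousSubmodule (Fin (n + 1)) O)).map φ), (∀ s, φ s = MvPolynomial.map π s) → ∀ Y : Set (AlgebraicGeometry.Proj (MvPolynomial.homogeneousSubmodule (Fin (n + 1)) O)), Y = Set.range (CategoryTheory.CategoryStruct.comp ι (AlgebraicGeometry.Proj.map φ hφ') : H ⟶ (AlgebraicGeometry.Proj (MvPolynomial.homogeneousSubmodule (Fin (n + 1)) O))) → ∃ (P' : AlgebraicGeometry.Scheme.{0}) (σ : P' ⟶ (AlgebraicGeometry.Proj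 (MvPolynomial.homogeneousSubmodule (Fin (n + 1)) O))) (S' : Set P'), (∀ Q : (∀ X' : AlgebraicGeometry.Scheme.{0}, (X' ⟶ (AlgebraicGeometry.Proj (MvPolynomial.homogeneousSubmodule (Fin (n + 1)) O))) → Set X' → Prop), Q (AlgebraicGeometry.Proj (MvPolynomial.homogeneousSubmodule (Fin (n + 1)) O)) (CategoryTheory.CategoryStruct.id _) Y → (∀ (X' X'' : AlgebraicGeometry.Scheme.{0}) (σ' : X' ⟶ (AlgebraicGeometry.Proj (MvPolynomial.homogeneousSubmodule (Fin (n + 1)) O))) (Y' : Set X') (C : X'.IdealSheafData) (τ : X'' ⟶ X'), Q X' σ' Y' → Literature.AlgebraicGeometry.Resolution.IsBlowup τ C → Literature.AlgebraicGeometry.Resolution.Scheme.IsRegular C.subscheme → σ' '' (C.support : Set X') ⊆ {x | ¬ IsGenericPoint x Y} → (C.support : Set X') ∩ (CategoryTheory.CategoryStruct.comp σ' (CategoryTheory.CategoryStruct.comp (AlgebraicGeometry.Proj.toSpecZero (MvPolynomial.homogeneousSubmodule (Fin (n + 1)) O)) (AlgebraicGeometry.Spec.map (CommRingCat.ofHom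 (algebraMap O (MvPolynomial.homogeneousSubmodule (Fin (n + 1)) O 0)))))) ⁻¹' {IsLocalRing.closedPoint O} ⊆ Y' → Q X'' (CategoryTheory.CategoryStruct.comp τ σ') (closure (τ ⁻¹' (Y' \ (C.support : Set X'))))) → Q P' σ S') ∧ IsIrreducible ((CategoryTheory.CategoryStruct.comp σ (CategoryTheory.CategoryStruct.comp (AlgebraicGeometry.Proj.toSpecZero (MvPolynomial.homogeneousSubmodule (Fin (n + 1)) O)) (AlgebraicGeometry.Spec.map (CommRingCat.ofHom (algebraMap O (MvPolynomial.homogeneousSubmodule (Fin (n + 1)) O 0)))))) ⁻¹' {IsLocalRing.closedPoint O}) ∧ Literature.AlgebraicGeometry.Resolution.Scheme.IsRegular (AlgebraicGeometry.Scheme.IdealSheafData.vanishingIdeal (⟨closure S', isClosed_closure⟩ : TopologicalSpace.Closeds P')).subscheme)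

/-! ## Pure logic -/

/-- Pure logic: the item is its `H`-binders in front of `ELNatAt` (`Iff.rfl`). [folklore] -/
theorem equisingularLiftNat_iff_forall_elNatAt (p : ℕ) :
    EquisingularLiftNat p ↔ (p.Prime → ∀ (k : Type) [Field k] [CharP k p] [IsAlgClosed k] (n : ℕ) (H : AlgebraicGeometry.Scheme.{0}) (ι : H ⟶ (Literature.AlgebraicGeometry.Motives.projectiveSpace n k).left), AlgebraicGeometry.IsClosedImmersion ι → AlgebraicGeometry.IsIntegral H → (∀ y : (Literature.AlgebraicGeometry.Motives.projectiveSpace n k).left, ∃ U : (Literature.AlgebraicGeometry.Motives.projectiveSpace n k).left.affineOpens, y ∈ (U : (Literature.AlgebraicGeometry.Motives.projectiveSpace n k).left.Opens) ∧ (ι.ker.ideal U).IsPrincipal) → ELNatAt p k n H ι) :=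
  Iff.rfl

/-- Pure logic: EL♮ over a fixed `(O, π)` with `π` surjective gives EL♮ at `H`. [folklore] -/
theorem elNatAt_of_elNatOver {p : ℕ} {k : Type} [Field k] [CharP k p] [IsAlgClosed k] {n : ℕ} {H : AlgebraicGeometry.Scheme.{0}}
    {ι : H ⟶ (Literature.AlgebraicGeometry.Motives.projectiveSpace n k).left} {O : Type} [CommRing O] [IsDomain O]
    [IsDiscreteValuationRing O] [CharZero O] {π : O →+* k} (hπ : Function.Surjective π) (h : ELNatOver p k n H ι O π) :
    ELNatAt p k n H ι :=
  ⟨O, inferInstance, inferInstance, inferInstance, inferInstance, π, hπ, h⟩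

/-- Pure logic: the item at `p`, applied to one `H` satisfying its binders, gives `ELNatAt`. [folklore] -/
theorem elNatAt_of_equisingularLiftNat {p : ℕ} (hE : EquisingularLiftNat p) (hp : p.Prime) {k : Type} [Field k] [CharP k p]
    [IsAlgClosed k] {n : ℕ} {H : AlgebraicGeometry.Scheme.{0}} {ι : H ⟶ (Literature.AlgebraicGeometry.Motives.projectiveSpace n k).left}
    (hι : AlgebraicGeometry.IsClosedImmersion ι) (hH : AlgebraicGeometry.IsIntegral H)
    (hloc : ∀ y : (Literature.AlgebraicGeometry.Motives.projectiveSpace n k).left,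
      ∃ U : (Literature.AlgebraicGeometry.Motives.projectiveSpace n k).left.affineOpens,
        y ∈ (U : (Literature.AlgebraicGeometry.Motives.projectiveSpace n k).left.Opens) ∧ (ι.ker.ideal U).IsPrincipal) :
    ELNatAt p k n H ι :=
  hE hp k n H ι hι hH hloc

/-- Pure logic: conversely, `ELNatAt` at every `H` satisfying the binders gives the item at `p`. [folklore] -/
theorem equisingularLiftNat_of_forall_elNatAt {p : ℕ}
    (h : p.Prime → ∀ (k : Type) [Field k] [CharP k p] [IsAlgClosed k] (n : ℕ) (H : AlgebraicGeometry.Scheme.{0}) (ι : H ⟶ (Literature.AlgebraicGeometry.Motives.projectiveSpace n k).left), AlgebraicGeometry.IsClosedImmersion ι → AlgebraicGeometry.IsIntegral H → (∀ y : (Literature.AlgebraicGeometry.Motives.projectiveSpace n k).left, ∃ U : (Literature.AlgebraicGeometry.Motives.projectiveSpace n k).left.affineOpens, y ∈ (U : (Literature.AlgebraicGeometry.Motives.projectiveSpace n k).left.Opens) ∧ (ι.ker.ideal U).IsPrincipal) → ELNatAt p k n H ι) : EquisingularLiftNat p :=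
  h

end EquisingularLift

end Summit.ResolutionOfSingularities.ResolutionOfSingularities.Theorems

end
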